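import Literature.AnabelianGeometry.EtaleTheta.SettingModelTateOriginShearTwoPower
import HarnessLib

/-!
# `IsTateOrigin` at the OPPOSITE orientation `j = −2`, and the IFF: `(modelχq p i j hj).IsTateOrigin ↔ j = 2 ∨ j = −2`

abc-iut cell, layer L2, R78 cluster STAGE 2 (integrator abc-iut-L6-d6), seat abc-iut-w5-d051 (gen 3; sequel of
`SettingModelTateOrigin` (`j = 2` ✓), `SettingModelTateOriginShearRigidity` / `…ShearTwoPower` (`IsTateOrigin ⇒ j = ±2`)).
Mochizuki, *The étale theta function …*, Publ. RIMS **45** (2009) [EtTh], §1 p. 13 [cite: MochizukiEtTh2009, §1 p.13]: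
«`(Δ^tp_Y)^ell ≅ Ẑ(1)`», «`G_{K_N}` acts trivially on `(Δ^tp_X)^ell/N·(Δ^tp_Y)^ell`», `K_N = K(ζ_N, q_X^{1/N})`.

* §1 general-`j` bookkeeping: `right_eq_one_and_eHat_eq_one_of_mem_dtpYqj`, `exists_coords_of_mem_ellPowersYj`;
* §2 `natCast_eq_neg_two_mul_of_apply_eq` — against the INVERSE generator `ζ_N⁻¹` of `μ_N` the Kummer class of
  `q_X = p²` reads `−2κ_p`: `σ((p^{1/N})²) = (ζ_N⁻¹)^m (p^{1/N})² ⇒ m ≡ −2κ_p(σ) (N)`;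
* §3 **`modelχq_negTwo_isTateOrigin`** — `(ThetaSetting.modelχq p i (−2) _).IsTateOrigin` for every `i`: the proof of
  `SettingModelTateOrigin.modelχq_isTateOrigin` with the data `y₁ = inl b`, `z = inl(η a, 1)`, `r = (p^{1/N})²` and the
  primitive root `ζ := ζ_N⁻¹` (the opposite orientation of `Ẑ(1)`): (a)/(a′) are orientation-free, (b) reads
  `χ_N(σ) = k` off ANY primitive `N`-th root (abc-iut-w5-d091's `levelChar_chi_eq_of_isPrimitiveRoot`), and in (c) the
  commutator `ê_b(σ·(η a,1)) = κ_p(σ)^{−2}` matches `m ≡ −2κ_p(σ)`;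
* §4 **`modelχq_isTateOrigin_iff`**: `(ThetaSetting.modelχq p i j hj).IsTateOrigin ↔ j = 2 ∨ j = −2` (every `i`), with
  `eq_two_or_neg_two_of_isTateOrigin`. The print-faithful Tate clause determines the shear exponent EXACTLY up to
  the orientation of `Ẑ(1)`: `|j| = 2 = v_p(q_X)`.

PROOF-ONLY (no definition, no named fact). Semi-synthetic model = consistency evidence only; nothing of [EtTh] asserted
for genuine tempered fundamental groups; no side is taken on [IUTchIII] Cor. 3.12; typed ≠ proved.
-/

noncomputable section

namespace Literature.AnabelianGeometry.EtaleTheta.SettingModel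

open Literature.AnabelianGeometry.SemiGraphs Thm16Sub Function Topology

section Model

variable (p : ℕ) [Fact p.Prime] (i j : ℤ) (hj : Even j)

/-! ### 1. General-`j` bookkeeping -/

/-- Elements of `Δ^tp_Y` of the stage-2 model (general shear): `right = 1`, `pr₂ left = 0`, `ê(pr₁ left) = 1`.
[cite: MochizukiEtTh2009, §1 p.12] -/
theorem right_eq_one_and_eHat_eq_one_of_mem_dtpYqj {y : PiTpχq p i j}
    (hy : y ∈ (ThetaSetting.modelχq p i j hj).DtpY) :
    y.right = 1 ∧ gfpSnd y.left = 1 ∧ eHat (gfpFst y.left) = 1 := by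
  obtain ⟨h1, h2⟩ := Subgroup.mem_inf.mp hy
  have hr : y.right = 1 := (mem_deltaTempχq_iff p i j y).mp h2
  have hs : gfpSnd y.left = 1 := by
    change y ∈ ((tateTwistData₀ p i j).toZ).ker at h1
    rwa [MonoidHom.mem_ker, GfpTwistData₀.toZ_apply] at h1
  exact ⟨hr, hs, eHat_gfpFst_eq_one hs⟩

/-- **Converse bookkeeping (general shear)**: every element of `N·(Δ^tp_Y)^ell` is `(inl q)^ell` for some `q` with
`pr₂ q = 0` and `ê_b(pr₁ q) ≡ 0 (N)`. [cite: MochizukiEtTh2009, §1 p.13] -/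
theorem exists_coords_of_mem_ellPowersYj (N : ℕ+) {e : (ThetaSetting.modelχq p i j hj).GtpEll}
    (he : e ∈ ellPowersY (ThetaSetting.modelχq p i j hj) N) :
    ∃ q : Gfp, gfpSnd q = 1 ∧ e = toEll (ThetaSetting.modelχq p i j hj) (SemidirectProduct.inl q) ∧
      ZHatLevel.level N (eHatB (gfpFst q)) = 1 := by
  set D := ThetaSetting.modelχq p i j hj with hD
  refine Subgroup.closure_induction (p := fun e _ => ∃ q : Gfp, gfpSnd q = 1 ∧
      e = toEll D (SemidirectProduct.inl q) ∧ ZHatLevel.level N (eHatB (gfpFst q)) = 1) ?_ ?_ ?_ ?_ he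
  · rintro _ ⟨_, ⟨y, hy, rfl⟩, rfl⟩
    obtain ⟨hyr, hys, -⟩ := right_eq_one_and_eHat_eq_one_of_mem_dtpYqj p i j hj hy
    refine ⟨y.left ^ (N : ℕ), by rw [map_pow, hys, one_pow], ?_, ?_⟩
    · change toEll D y ^ (N : ℕ) = _
      rw [← map_pow (toEll D)]
      congr 1
      conv_lhs => rw [eq_inl_of_right_eq_oneq p i j hyr]
      rw [← map_pow]
    · rw [map_pow, map_pow, ZHatLevel.level_pow_self]
  · exact ⟨1, map_one _, by rw [map_one, map_one], by rw [map_one, map_one, map_one]⟩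
  · rintro e₁ e₂ - - ⟨q₁, hq₁, rfl, hl₁⟩ ⟨q₂, hq₂, rfl, hl₂⟩
    refine ⟨q₁ * q₂, by rw [map_mul, hq₁, hq₂, mul_one], by rw [← map_mul, ← map_mul], ?_⟩
    rw [map_mul, map_mul, map_mul, hl₁, hl₂, mul_one]
  · rintro e - ⟨q, hq, rfl, hl⟩
    refine ⟨q⁻¹, by rw [map_inv, hq, inv_one], by rw [← map_inv, ← map_inv], ?_⟩
    rw [map_inv, map_inv, map_inv, hl, inv_one]

/-! ### 2. The Kummer class of `q_X = p²` against the inverse generator `ζ_N⁻¹` -/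

/-- **`σ r = (ζ_N⁻¹)^m · r` for `r = (p^{1/N})²` forces `m ≡ −2κ_p(σ) (mod N)`.** [cite: NeukirchANT1999, Ch. IV §3] -/
theorem natCast_eq_neg_two_mul_of_apply_eq (σ : GQp p) (N : ℕ+) {m : ℕ}
    (h : σ (pRoot p N ^ 2) =
      ((((cycGen p : ℕ+ → (PadicAlgCl p)ˣ) N : (PadicAlgCl p)ˣ) : PadicAlgCl p)⁻¹) ^ m * pRoot p N ^ 2) :
    (m : ZMod N) = -(2 * Multiplicative.toAdd (ZHatLevel.level N (kappaP p σ))) := by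
  haveI : NeZero (N : ℕ) := ⟨N.ne_zero⟩
  set ζ := (((cycGen p : ℕ+ → (PadicAlgCl p)ˣ) N : (PadicAlgCl p)ˣ) : PadicAlgCl p) with hζdef
  set c := (Multiplicative.toAdd (ZHatLevel.level N (kappaP p σ))).val with hc
  have hζ : IsPrimitiveRoot ζ (N : ℕ) := isPrimitiveRoot_coe_cycGen p N
  have hr0 : pRoot p N ^ 2 ≠ 0 := pow_ne_zero 2 (pRoot_ne_zero p N)
  rw [apply_pRoot_sq] at h
  have hpow : ζ ^ (2 * c) = ζ⁻¹ ^ m := mul_right_cancel₀ hr0 h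
  have hone : ζ ^ (2 * c + m) = 1 := by
    rw [pow_add, hpow, inv_pow, inv_mul_cancel₀ (pow_ne_zero m (hζ.ne_zero N.ne_zero))]
  have hdvd : (N : ℕ) ∣ 2 * c + m := (hζ.pow_eq_one_iff_dvd _).mp hone
  have hcast : ((2 * c + m : ℕ) : ZMod N) = 0 := (ZMod.natCast_eq_zero_iff _ _).mpr hdvd
  rw [Nat.cast_add, Nat.cast_mul, Nat.cast_ofNat, hc, ZMod.natCast_zmod_val] at hcast
  exact eq_neg_of_add_eq_zero_right hcast

/-! ### 3. `IsTateOrigin` at `j = −2` -/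

/-- **`IsTateOrigin` HOLDS at the oppositely oriented Tate-sheared model `ThetaSetting.modelχq p i (−2) _`** (every
inner exponent `i`): at each level `N`, `y₁ = inl b`, `z = inl(η a, 1)`, `ζ = ζ_N⁻¹`, `r = (p^{1/N})²`.
[cite: MochizukiEtTh2009, §1 p.13] -/
theorem modelχq_negTwo_isTateOrigin : (ThetaSetting.modelχq p i (-2) (Even.neg even_two)).IsTateOrigin := by
  set D := ThetaSetting.modelχq p i (-2) (Even.neg even_two) with hD
  refine ⟨fun N => ?_⟩
  haveI : NeZero (N : ℕ) := ⟨N.ne_zero⟩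
  -- the data
  let bG : Gfp := bPowGfp (iotaZ (Multiplicative.ofAdd 1))
  let aG : Gfp := ⟨(eta (FreeGroup.of 0), Multiplicative.ofAdd (1 : ℤ)), eta_a_mem_Gfpq⟩
  let y₁ : D.PiTemp := (SemidirectProduct.inl bG : PiTpχq p i (-2))
  let z : D.PiTemp := (SemidirectProduct.inl aG : PiTpχq p i (-2))
  let ζ₀ : PadicAlgCl p := (((cycGen p : ℕ+ → (PadicAlgCl p)ˣ) N : (PadicAlgCl p)ˣ) : PadicAlgCl p)
  let ζ : PadicAlgCl p := ζ₀⁻¹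
  let r : PadicAlgCl p := pRoot p N ^ 2
  have hζ₀ : IsPrimitiveRoot ζ₀ (N : ℕ) := isPrimitiveRoot_coe_cycGen p N
  have hζ : IsPrimitiveRoot ζ (N : ℕ) := hζ₀.inv
  have hbG_x : eHat (gfpFst bG) = 1 := by rw [gfpFst_bPowGfp, eHat_bPow]
  have hbG_y : eHatB (gfpFst bG) = iotaZ (Multiplicative.ofAdd 1) := by rw [gfpFst_bPowGfp, eHatB_bPow]
  have hy₁ : y₁ ∈ D.DtpY := inl_bPowGfp_mem_dtpYqj p i (-2) (Even.neg even_two) _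
  have hz : z ∈ D.DeltaTemp := (mem_deltaTempχq_iff p i (-2) _).mpr (SemidirectProduct.right_inl _)
  have hzZ : D.toZ z = Multiplicative.ofAdd 1 := by
    change (tateTwistData₀ p i (-2)).toZ _ = _
    rw [GfpTwistData₀.toZ_apply, SemidirectProduct.left_inl, gfpSnd_apply]
  -- the level-`N` character
  let lev : ZH →* Multiplicative (ZMod N) := ZHatLevel.level N
  have hlev : ∀ t : ZH, lev t = ZHatLevel.level N t := fun _ => rfl
  have hlev_one : lev (iotaZ (Multiplicative.ofAdd 1)) = Multiplicative.ofAdd 1 := by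
    rw [hlev, iotaZ_one_eq, ZHatLevel.level_eta, Int.cast_one]
  have hlev_bG : lev (eHatB (gfpFst bG)) = Multiplicative.ofAdd 1 := by rw [hbG_y]; exact hlev_one
  have hlev_aut : ∀ (φ : MulAut ZH) (t : ZH),
      Multiplicative.toAdd (lev (φ t)) = ZHatLevel.levelChar N φ * Multiplicative.toAdd (lev t) :=
    fun φ t => ZHatLevel.toAdd_level_aut N φ t
  refine ⟨y₁, z, ζ, r, hy₁, hz, hzZ, hζ, pRoot_sq_pow p N, ?_, ?_, ?_, ?_⟩
  · -- (a) generation: `y ≡ y₁^{ê_b(y) mod N}` modulo `N`-th powers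
    intro y hy
    obtain ⟨hyr, -, hyx⟩ := right_eq_one_and_eHat_eq_one_of_mem_dtpYqj p i (-2) (Even.neg even_two) hy
    set v : ZMod N := Multiplicative.toAdd (lev (eHatB (gfpFst y.left))) with hv
    refine ⟨v.val, ?_⟩
    rw [← map_pow (toEll D), ← map_inv (toEll D), ← map_mul (toEll D), eq_inl_of_right_eq_oneq p i (-2) hyr]
    change toEll D (SemidirectProduct.inl y.left * ((SemidirectProduct.inl bG : PiTpχq p i (-2)) ^ v.val)⁻¹) ∈ _
    rw [← map_pow (SemidirectProduct.inl : Gfp →* PiTpχq p i (-2)),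
      ← map_inv (SemidirectProduct.inl : Gfp →* PiTpχq p i (-2)),
      ← map_mul (SemidirectProduct.inl : Gfp →* PiTpχq p i (-2))]
    refine toEll_inl_mem_ellPowersYj p i (-2) (Even.neg even_two) N ?_ ?_
    · simp only [map_mul, map_inv, map_pow, hyx, hbG_x, one_pow, inv_one, mul_one]
    · show lev (eHatB (gfpFst (y.left * (bG ^ v.val)⁻¹))) = 1
      simp only [map_mul, map_inv, map_pow]
      rw [hlev_bG, ← ofAdd_nsmul, nsmul_eq_mul, mul_one, ZMod.natCast_zmod_val, hv, ofAdd_toAdd, mul_inv_cancel]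
  · -- (a′) `ȳ₁^k ∈ N·(Δ^tp_Y)^ell ↔ N ∣ k`
    intro k
    constructor
    · intro hk
      obtain ⟨q, -, hq, hl⟩ := exists_coords_of_mem_ellPowersYj p i (-2) (Even.neg even_two) N hk
      rw [← map_pow (toEll D)] at hq
      change toEll D ((SemidirectProduct.inl bG : PiTpχq p i (-2)) ^ k) = _ at hq
      rw [← map_pow (SemidirectProduct.inl : Gfp →* PiTpχq p i (-2)), toEll_modelχqj_eq_iff, ← map_inv, ← map_mul,
        inl_mem_ellKerχq_iff] at hq
      obtain ⟨-, hy⟩ := hq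
      rw [map_mul, map_inv, map_pow, map_mul, map_inv, map_pow, hbG_y, inv_mul_eq_one] at hy
      have h1 : lev (iotaZ (Multiplicative.ofAdd 1) ^ k) = 1 := by rw [hy]; exact hl
      rw [map_pow, hlev_one, ← ofAdd_nsmul, nsmul_eq_mul, mul_one, ofAdd_eq_one, ZMod.natCast_eq_zero_iff] at h1
      exact h1
    · rintro ⟨m, rfl⟩
      rw [pow_mul', ← map_pow (toEll D)]
      exact Subgroup.subset_closure ⟨toEll D (y₁ ^ m), ⟨y₁ ^ m, D.DtpY.pow_mem hy₁ m, rfl⟩, rfl⟩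
  · -- (b) Tate twist: `ê_b(σ·q) = χ(σ) ê_b(q)` on `Δ^tp_Y`, and `χ_N(σ) = k` when `σ ζ = ζ^k` for the primitive `ζ = ζ_N⁻¹`
    intro g k hk y hy
    have hχ : ZHatLevel.levelChar N (chi p g.right) = (k : ZMod N) :=
      levelChar_chi_eq_of_isPrimitiveRoot p g.right N hζ hk
    obtain ⟨hyr, hys, hyx⟩ := right_eq_one_and_eHat_eq_one_of_mem_dtpYqj p i (-2) (Even.neg even_two) hy
    rw [← map_pow (toEll D), ← map_inv (toEll D), ← map_mul (toEll D), eq_inl_of_right_eq_oneq p i (-2) hyr,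
      conj_inl_eqq,
      ← map_pow (SemidirectProduct.inl : Gfp →* PiTpχq p i (-2)),
      ← map_inv (SemidirectProduct.inl : Gfp →* PiTpχq p i (-2)),
      ← map_mul (SemidirectProduct.inl : Gfp →* PiTpχq p i (-2))]
    refine toEll_inl_mem_ellPowersYj p i (-2) (Even.neg even_two) N ?_ ?_
    · simp only [map_mul, map_inv, map_pow, eHat_gfpFst_actχq, hyx, one_pow, inv_one, mul_one, mul_inv_cancel]
    · show lev (eHatB (gfpFst (g.left * actχq p i (-2) g.right y.left * g.left⁻¹ * (y.left ^ k)⁻¹))) = 1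
      simp only [map_mul, map_inv, map_pow, eHatB_gfpFst_actχq_of_gfpSnd_eq_one p i (-2) g.right hys]
      rw [mul_inv_cancel_comm]
      apply Multiplicative.toAdd.injective
      rw [toAdd_mul, toAdd_inv, toAdd_pow, hlev_aut, hχ, toAdd_one, nsmul_eq_mul, add_neg_cancel]
  · -- (c) Kummer class of `q_X = p²` against `ζ_N⁻¹`: `ê_b(σ·(η a, 1)) = κ_p(σ)^{-2}` and `m ≡ -2κ_p(σ)`
    intro g m hm
    have haug : D.aug g = g.right := rfl
    rw [haug] at hm
    have hm2 : (m : ZMod N) = -(2 * Multiplicative.toAdd (ZHatLevel.level N (kappaP p g.right))) :=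
      natCast_eq_neg_two_mul_of_apply_eq p g.right N hm
    have hEx : eHat (gfpFst (actχq p i (-2) g.right aG)) = iotaZ (Multiplicative.ofAdd 1) :=
      eHat_gfpFst_actχq_eta_a p i (-2) g.right
    have hEy : lev (eHatB (gfpFst (actχq p i (-2) g.right aG))) = lev (kappaP p g.right) ^ (-2 : ℤ) := by
      rw [show eHatB (gfpFst (actχq p i (-2) g.right aG)) = kappaP p g.right ^ (-2 : ℤ) from
        eHatB_gfpFst_actχq_eta_a p i (-2) g.right, map_zpow]
    have haG_x : eHat (gfpFst aG) = iotaZ (Multiplicative.ofAdd 1) := by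
      rw [gfpFst_apply]
      change eHat (eta (FreeGroup.of 0)) = _
      rw [eHat_eta, expA_apply, heisHom_of_zero]
    have haG_y : eHatB (gfpFst aG) = 1 := by
      rw [gfpFst_apply]
      exact eHatB_eta_of_zero
    change toEll D (g * SemidirectProduct.inl aG * g⁻¹ * (SemidirectProduct.inl aG)⁻¹) *
        (toEll D (SemidirectProduct.inl bG) ^ m)⁻¹ ∈ _
    rw [← map_pow (toEll D), ← map_inv (toEll D), ← map_mul (toEll D), conj_inl_eqq,
      ← map_inv (SemidirectProduct.inl : Gfp →* PiTpχq p i (-2)),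
      ← map_mul (SemidirectProduct.inl : Gfp →* PiTpχq p i (-2)),
      ← map_pow (SemidirectProduct.inl : Gfp →* PiTpχq p i (-2)),
      ← map_inv (SemidirectProduct.inl : Gfp →* PiTpχq p i (-2)),
      ← map_mul (SemidirectProduct.inl : Gfp →* PiTpχq p i (-2))]
    refine toEll_inl_mem_ellPowersYj p i (-2) (Even.neg even_two) N ?_ ?_
    · simp only [map_mul, map_inv, map_pow, hEx, haG_x, hbG_x, one_pow, inv_one, mul_one]
      rw [Literature.AnabelianGeometry.AbsoluteAnabelian.ZHatCompletion.mul_comm (eHat (gfpFst g.left))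
        (iotaZ (Multiplicative.ofAdd 1))]
      group
    · show lev (eHatB (gfpFst (g.left * actχq p i (-2) g.right aG * g.left⁻¹ * aG⁻¹ * (bG ^ m)⁻¹))) = 1
      simp only [map_mul, map_inv, map_pow, haG_y, inv_one, mul_one, hlev_bG, hEy]
      rw [mul_inv_cancel_comm]
      apply Multiplicative.toAdd.injective
      rw [toAdd_mul, toAdd_inv, toAdd_pow, toAdd_zpow, toAdd_ofAdd, toAdd_one, nsmul_eq_mul, mul_one, hm2,
        zsmul_eq_mul, hlev]
      push_cast
      ring

/-! ### 4. The IFF -/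

/-- **`(ThetaSetting.modelχq p i j hj).IsTateOrigin ↔ j = 2 ∨ j = −2`** (every inner exponent `i`): the print-faithful
Tate-module clause determines the shear exponent of the stage-2 model exactly up to the orientation of `Ẑ(1)`.
[cite: MochizukiEtTh2009, §1 p.13] -/
theorem modelχq_isTateOrigin_iff : (ThetaSetting.modelχq p i j hj).IsTateOrigin ↔ j = 2 ∨ j = -2 := by
  refine ⟨eq_two_or_neg_two_of_isTateOrigin p i j hj, ?_⟩
  rintro (rfl | rfl)
  · exact modelχq_isTateOrigin p i
  · exact modelχq_negTwo_isTateOrigin p i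

/-- **Both orientations are jointly consistent with root + guard**: for `j = 2` and `j = −2` the stage-2 record is a
`ThetaSetting` with the guard AND the full Tate-module clause. [cite: MochizukiEtTh2009, §1 p.13] -/
theorem modelχq_isEtThOrigin_and_isTateOrigin_of_abs (hj2 : j = 2 ∨ j = -2) :
    (ThetaSetting.modelχq p i j hj).IsEtThOrigin ∧ (ThetaSetting.modelχq p i j hj).IsTateOrigin :=
  ⟨ThetaSetting.modelχq_isEtThOrigin p i j hj, (modelχq_isTateOrigin_iff p i j hj).mpr hj2⟩

end Model

end Literature.AnabelianGeometry.EtaleTheta.SettingModel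

end
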